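import Mathlib
import Summits.NavierStokesRegularity.NavierStokesRegularity.Theorems.WakeRatchetTailRatchetScalarFrontAdmissible
import Summits.NavierStokesRegularity.NavierStokesRegularity.Theorems.WakeRatchetBlockRatioLeOne
import HarnessLib

/-!
# Scalar dyadic fronts (construction `DyadicScalarFronts`, stmt-NavierStokesRegularity-21808):
# every non-trivial admissible front strands a STRICTLY POSITIVE wake — no perfect conveyor

For a profile `a` of the scalar front equation `a' = (Λ/s²)a(·/s)² − (s/Λ)a·a(s·)` on `t < 0` with the
admissibility clauses of the construction item (integrable on `(−∞,0)`, bounded near `0⁻`), integrating the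
equation itself over the whole life of the shell gives the exact MASS identity (`wake_eq`)

  `L = a(0⁻) = (Λ/s)·I − (s/Λ)·J`,   `I = ∫_{t<0} a²`,  `J = ∫_{t<0} a(t)a(st) dt`,

and the elementary bound `J ≤ (I + I/s)/2` (`2xy ≤ x² + y²` and the substitution `u = st`) yields the
QUANTITATIVE WAKE FLOOR (`wake_lower_bound`)

  `a(0⁻) ≥ I·(2Λ² − s² − s)/(2sΛ)`.

Since a non-trivial admissible front is sub-unitary (`s ≤ Λ`, the tree's `IsDSSWave.dssMu_le_one` through
the dictionary) and `Λ > 1`, the factor is positive: EVERY NON-TRIVIAL ADMISSIBLE SCALAR DYADIC FRONT HAS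
`a(0⁻) > 0` (`wake_pos_of_front`) — whatever its sign pattern — and therefore, by the wake–throughput identity
of the companion file, `s < Λ` STRICTLY, i.e. `μ = dssMu ε₀ (log s) < 1` (`dssMu_lt_one_of_front`): an exact
DSS front of the dyadic member cannot be a perfect conveyor (`μ = 1`), it always leaves energy behind.  (The
crux `TailRatchet` asked for this retention to be bounded below UNIFORMLY in `ε₀`; the kit value is
`1 − μ ≈ (5/3)ε₀`, and the floor proved here degenerates like `2Λ² − s² − s → 0⁺` only if `s → Λ → 1`.)

HONEST FRAMING: elementary real analysis about a MODEL lattice ODE (Tao 2016 §1.2, §4); existence of such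
fronts stays open; nothing here concerns the Navier–Stokes equations; no item is closed.
-/

noncomputable section

set_option linter.dupNamespace false

namespace Summit.NavierStokesRegularity.NavierStokesRegularity.Theorems

namespace WakeRatchetScalarFrontPositiveWake

open Filter Topology Set MeasureTheory intervalIntegral
open Literature.Analysis.FluidPDE Literature.Analysis.FluidPDE.TaoCascade
open WakeRatchetDyadicFront WakeRatchetScalarFront WakeRatchetScalarFrontWake WakeRatchetScalarFrontAdmissible

variable {ε₀ s P : ℝ} {a : ℝ → ℝ}

/-! ## Integrability and substitution on the half-line `t < 0` -/

/-- `a²` is integrable on `(−∞,0)` for a bounded integrable profile. [elementary] -/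
theorem integrableOn_sq (hcont : ContinuousOn a (Iio 0)) (hP : ∀ t : ℝ, t < 0 → |a t| ≤ P)
    (hint : IntegrableOn a (Iio 0)) : IntegrableOn (fun t => a t ^ 2) (Iio 0) := by
  refine Integrable.mono' (g := fun t => P * |a t|) ((hint.abs).const_mul P)
    ((hcont.pow 2).aestronglyMeasurable measurableSet_Iio) ?_
  refine (ae_restrict_iff' measurableSet_Iio).2 (Eventually.of_forall fun t ht => ?_)
  rw [Real.norm_eq_abs, abs_pow, sq]
  exact mul_le_mul_of_nonneg_right (hP t ht) (abs_nonneg _)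

/-- The indicator of `(−∞,0)` commutes with the dilations `t ↦ t/s`, `t ↦ st` (`s > 0`). [elementary] -/
theorem indicator_comp_div {f : ℝ → ℝ} (hs : 0 < s) :
    (fun x => indicator (Iio (0 : ℝ)) f (x / s)) = indicator (Iio 0) (fun x => f (x / s)) := by
  funext x
  by_cases hx : x < 0
  · have hx' : x / s < 0 := div_neg_of_neg_of_pos hx hs
    rw [indicator_of_mem (show x / s ∈ Iio (0:ℝ) from hx'), indicator_of_mem (show x ∈ Iio (0:ℝ) from hx)]
  · have hx' : ¬ x / s < 0 := by
      intro h; exact hx (by rwa [div_lt_iff₀ hs, zero_mul] at h)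
    rw [indicator_of_notMem (show x / s ∉ Iio (0:ℝ) from hx'),
      indicator_of_notMem (show x ∉ Iio (0:ℝ) from hx)]

/-- [elementary] -/
theorem indicator_comp_mul {f : ℝ → ℝ} (hs : 0 < s) :
    (fun x => indicator (Iio (0 : ℝ)) f (s * x)) = indicator (Iio 0) (fun x => f (s * x)) := by
  funext x
  by_cases hx : x < 0
  · have hx' : s * x < 0 := mul_neg_of_pos_of_neg hs hx
    rw [indicator_of_mem (show s * x ∈ Iio (0:ℝ) from hx'), indicator_of_mem (show x ∈ Iio (0:ℝ) from hx)]
  · have hx' : ¬ s * x < 0 := by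
      intro h; exact hx (by nlinarith)
    rw [indicator_of_notMem (show s * x ∉ Iio (0:ℝ) from hx'),
      indicator_of_notMem (show x ∉ Iio (0:ℝ) from hx)]

/-- Dilation preserves integrability on `(−∞,0)`: `t ↦ f(t/s)`. [elementary] -/
theorem integrableOn_comp_div {f : ℝ → ℝ} (hs : 0 < s) (hf : IntegrableOn f (Iio 0)) :
    IntegrableOn (fun t => f (t / s)) (Iio 0) := by
  have h1 := (hf.integrable_indicator measurableSet_Iio).comp_div hs.ne'
  rw [indicator_comp_div hs] at h1
  exact (integrable_indicator_iff measurableSet_Iio).1 h1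

/-- Dilation preserves integrability on `(−∞,0)`: `t ↦ f(st)`. [elementary] -/
theorem integrableOn_comp_mul {f : ℝ → ℝ} (hs : 0 < s) (hf : IntegrableOn f (Iio 0)) :
    IntegrableOn (fun t => f (s * t)) (Iio 0) := by
  have h1 := (hf.integrable_indicator measurableSet_Iio).comp_mul_left' hs.ne'
  rw [indicator_comp_mul hs] at h1
  exact (integrable_indicator_iff measurableSet_Iio).1 h1

/-- Substitution `u = t/s` on the half-line: `∫_{t<0} f(t/s) = s ∫_{t<0} f`. [elementary] -/
theorem integral_comp_div_Iio (f : ℝ → ℝ) (hs : 0 < s) :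
    ∫ t in Iio 0, f (t / s) = s * ∫ t in Iio 0, f t := by
  rw [← MeasureTheory.integral_indicator measurableSet_Iio, ← MeasureTheory.integral_indicator measurableSet_Iio,
    ← indicator_comp_div hs, Measure.integral_comp_div (indicator (Iio 0) f) s, abs_of_pos hs, smul_eq_mul]

/-- Substitution `u = st` on the half-line: `∫_{t<0} f(st) = s⁻¹ ∫_{t<0} f`. [elementary] -/
theorem integral_comp_mul_Iio (f : ℝ → ℝ) (hs : 0 < s) :
    ∫ t in Iio 0, f (s * t) = s⁻¹ * ∫ t in Iio 0, f t := by
  rw [← MeasureTheory.integral_indicator measurableSet_Iio, ← MeasureTheory.integral_indicator measurableSet_Iio,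
    ← indicator_comp_mul hs, Measure.integral_comp_mul_left (indicator (Iio 0) f) s,
    abs_of_pos (inv_pos.2 hs), smul_eq_mul]

/-! ## The mass identity and the wake floor -/

/-- **Mass identity.**  For a bounded integrable profile of the front equation entering from rest with wake
limit `L`: `L = (Λ/s)∫_{t<0} a² − (s/Λ)∫_{t<0} a(t)a(st) dt` (integrate the equation over `(−∞,0)`,
substitute `u = t/s` in the feed term). [cite: Tao2016AveragedNS, §1.2 (dyadic model); elementary] -/
theorem wake_eq (hε : 0 < ε₀) (hs : 1 < s)
    (hode : ∀ t : ℝ, t < 0 → HasDerivAt a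
      (bigLam ε₀ / s ^ 2 * a (t / s) ^ 2 - s / bigLam ε₀ * a t * a (s * t)) t)
    (hP : ∀ t : ℝ, t < 0 → |a t| ≤ P) (hint : IntegrableOn a (Iio 0))
    (hbot : Tendsto a atBot (𝓝 0)) {L : ℝ} (hL : Tendsto a (𝓝[<] 0) (𝓝 L)) :
    L = bigLam ε₀ / s * (∫ t in Iio 0, a t ^ 2) - s / bigLam ε₀ * ∫ t in Iio 0, a t * a (s * t) := by
  have hΛ : 0 < bigLam ε₀ := bigLam_pos (by linarith)
  have hs0 : 0 < s := by linarith
  have hP0 : 0 ≤ P := by have := hP (-1) (by norm_num); exact (abs_nonneg _).trans this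
  have hcont := continuousOn_of_ode hode
  have hsq : IntegrableOn (fun t => a t ^ 2) (Iio 0) := integrableOn_sq hcont hP hint
  -- the two pieces of the right-hand side are integrable on `(−∞,0)`
  have hfeed : IntegrableOn (fun t => a (t / s) ^ 2) (Iio 0) := integrableOn_comp_div hs0 hsq
  have hmaps : MapsTo (fun t : ℝ => s * t) (Iio 0) (Iio 0) := fun t ht => mul_neg_of_pos_of_neg hs0 ht
  have hdrainc : ContinuousOn (fun t => a t * a (s * t)) (Iio 0) :=
    hcont.mul (hcont.comp (continuous_const.mul continuous_id).continuousOn hmaps)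
  have hdrain : IntegrableOn (fun t => a t * a (s * t)) (Iio 0) := by
    refine Integrable.mono' (g := fun t => P * |a t|) ((hint.abs).const_mul P)
      (hdrainc.aestronglyMeasurable measurableSet_Iio) ?_
    refine (ae_restrict_iff' measurableSet_Iio).2 (Eventually.of_forall fun t ht => ?_)
    rw [Real.norm_eq_abs, abs_mul, mul_comm]
    exact mul_le_mul_of_nonneg_right (hP _ (hmaps ht)) (abs_nonneg _)
  have hrhs : IntegrableOn (fun t => bigLam ε₀ / s ^ 2 * a (t / s) ^ 2 - s / bigLam ε₀ * a t * a (s * t))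
      (Iio 0) := by
    have h0 : IntegrableOn (fun t => bigLam ε₀ / s ^ 2 * a (t / s) ^ 2 - s / bigLam ε₀ * (a t * a (s * t)))
        (Iio 0) := (hfeed.const_mul (bigLam ε₀ / s ^ 2)).sub (hdrain.const_mul (s / bigLam ε₀))
    exact IntegrableOn.congr_fun h0 (fun t _ => by ring) measurableSet_Iio
  -- FTC with one-sided limits on `(A, 0)`
  have hbal : ∀ A : ℝ, A < 0 → L - a A
      = bigLam ε₀ / s ^ 2 * (∫ t in A..0, a (t / s) ^ 2) - s / bigLam ε₀ * ∫ t in A..0, a t * a (s * t) := by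
    intro A hA
    have hftc := intervalIntegral.integral_eq_sub_of_hasDerivAt_of_tendsto hA
      (fun t ht => hode t ht.2) (intervalIntegrable_of_Iio hrhs hA.le)
      ((hode A hA).continuousAt.continuousWithinAt.tendsto) hL
    rw [← hftc]
    have e : ∀ t, bigLam ε₀ / s ^ 2 * a (t / s) ^ 2 - s / bigLam ε₀ * a t * a (s * t)
        = bigLam ε₀ / s ^ 2 * a (t / s) ^ 2 - s / bigLam ε₀ * (a t * a (s * t)) := fun t => by ring
    simp_rw [e]
    rw [intervalIntegral.integral_sub ((intervalIntegrable_of_Iio hfeed hA.le).const_mul _)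
      ((intervalIntegrable_of_Iio hdrain hA.le).const_mul _), intervalIntegral.integral_const_mul,
      intervalIntegral.integral_const_mul]
  -- let `A → −∞`
  have hfeedIic : IntegrableOn (fun t => a (t / s) ^ 2) (Iic 0) :=
    (integrableOn_Iic_iff_integrableOn_Iio (by finiteness)).2 hfeed
  have hdrainIic : IntegrableOn (fun t => a t * a (s * t)) (Iic 0) :=
    (integrableOn_Iic_iff_integrableOn_Iio (by finiteness)).2 hdrain
  have hlim1 := intervalIntegral_tendsto_integral_Iic 0 hfeedIic tendsto_id
  have hlim2 := intervalIntegral_tendsto_integral_Iic 0 hdrainIic tendsto_id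
  have hR := (hlim1.const_mul (bigLam ε₀ / s ^ 2)).sub (hlim2.const_mul (s / bigLam ε₀))
  have hLft : Tendsto (fun A : ℝ => L - a A) atBot (𝓝 (L - 0)) := tendsto_const_nhds.sub hbot
  have heq : (fun A : ℝ => L - a A) =ᶠ[atBot]
      (fun A : ℝ => bigLam ε₀ / s ^ 2 * (∫ t in A..0, a (t / s) ^ 2)
        - s / bigLam ε₀ * ∫ t in A..0, a t * a (s * t)) := by
    filter_upwards [eventually_lt_atBot (0 : ℝ)] with A hA using hbal A hA
  have hfin := tendsto_nhds_unique_of_eventuallyEq hLft hR heq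
  rw [sub_zero, integral_Iic_eq_integral_Iio, integral_Iic_eq_integral_Iio,
    integral_comp_div_Iio (fun t => a t ^ 2) hs0] at hfin
  rw [hfin]
  field_simp

/-- **Wake floor.**  Under the same hypotheses, `a(0⁻) ≥ (2Λ² − s² − s)/(2sΛ) · ∫_{t<0} a²`
(`2a(t)a(st) ≤ a(t)² + a(st)²` and `∫ a(s·)² = s⁻¹ ∫ a²`).
[cite: Tao2016AveragedNS, §1.2; elementary] -/
theorem wake_lower_bound (hε : 0 < ε₀) (hs : 1 < s)
    (hode : ∀ t : ℝ, t < 0 → HasDerivAt a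
      (bigLam ε₀ / s ^ 2 * a (t / s) ^ 2 - s / bigLam ε₀ * a t * a (s * t)) t)
    (hP : ∀ t : ℝ, t < 0 → |a t| ≤ P) (hint : IntegrableOn a (Iio 0))
    (hbot : Tendsto a atBot (𝓝 0)) {L : ℝ} (hL : Tendsto a (𝓝[<] 0) (𝓝 L)) :
    (2 * bigLam ε₀ ^ 2 - s ^ 2 - s) / (2 * s * bigLam ε₀) * (∫ t in Iio 0, a t ^ 2) ≤ L := by
  have hΛ : 0 < bigLam ε₀ := bigLam_pos (by linarith)
  have hs0 : 0 < s := by linarith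
  have hcont := continuousOn_of_ode hode
  have hsq : IntegrableOn (fun t => a t ^ 2) (Iio 0) := integrableOn_sq hcont hP hint
  have hsqs : IntegrableOn (fun t => a (s * t) ^ 2) (Iio 0) := integrableOn_comp_mul hs0 hsq
  have hmaps : MapsTo (fun t : ℝ => s * t) (Iio 0) (Iio 0) := fun t ht => mul_neg_of_pos_of_neg hs0 ht
  have hdrainc : ContinuousOn (fun t => a t * a (s * t)) (Iio 0) :=
    hcont.mul (hcont.comp (continuous_const.mul continuous_id).continuousOn hmaps)
  have hdrain : IntegrableOn (fun t => a t * a (s * t)) (Iio 0) := by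
    refine Integrable.mono' (g := fun t => P * |a t|) ((hint.abs).const_mul P)
      (hdrainc.aestronglyMeasurable measurableSet_Iio) ?_
    refine (ae_restrict_iff' measurableSet_Iio).2 (Eventually.of_forall fun t ht => ?_)
    rw [Real.norm_eq_abs, abs_mul, mul_comm]
    exact mul_le_mul_of_nonneg_right (hP _ (hmaps ht)) (abs_nonneg _)
  set I : ℝ := ∫ t in Iio 0, a t ^ 2 with hI
  -- `J ≤ (I + I/s)/2`
  have hJ : ∫ t in Iio 0, a t * a (s * t) ≤ (I + s⁻¹ * I) / 2 := by
    have h1 : ∫ t in Iio 0, a t * a (s * t) ≤ ∫ t in Iio 0, (a t ^ 2 + a (s * t) ^ 2) / 2 :=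
      integral_mono hdrain ((hsq.add hsqs).div_const 2)
        (fun t => by nlinarith [sq_nonneg (a t - a (s * t))])
    have h2 : ∫ t in Iio 0, (a t ^ 2 + a (s * t) ^ 2) / 2 = (I + s⁻¹ * I) / 2 := by
      rw [MeasureTheory.integral_div, integral_add hsq hsqs, integral_comp_mul_Iio (fun t => a t ^ 2) hs0]
    linarith
  have h := wake_eq hε hs hode hP hint hbot hL
  have hJ' : s / bigLam ε₀ * ∫ t in Iio 0, a t * a (s * t) ≤ s / bigLam ε₀ * ((I + s⁻¹ * I) / 2) :=
    mul_le_mul_of_nonneg_left hJ (by positivity)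
  have e : (2 * bigLam ε₀ ^ 2 - s ^ 2 - s) / (2 * s * bigLam ε₀) * I
      = bigLam ε₀ / s * I - s / bigLam ε₀ * ((I + s⁻¹ * I) / 2) := by
    field_simp
    ring
  rw [e, h]
  linarith

/-- The wake floor is POSITIVE for a sub-unitary front: `s ≤ Λ`, `Λ > 1` ⟹ `2Λ² − s² − s > 0`.
[elementary] -/
theorem floor_coeff_pos (hε : 0 < ε₀) (hs : 1 < s) (hsΛ : s ≤ bigLam ε₀) :
    0 < (2 * bigLam ε₀ ^ 2 - s ^ 2 - s) / (2 * s * bigLam ε₀) := by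
  have hΛ1 : 1 < bigLam ε₀ := by
    unfold bigLam; exact Real.one_lt_rpow (by linarith) (by norm_num)
  have hs0 : 0 < s := by linarith
  apply div_pos _ (by positivity)
  nlinarith

/-- A non-trivial profile has positive energy `∫_{t<0} a² > 0` (continuity at a point where `a ≠ 0`).
[elementary] -/
theorem sq_integral_pos
    (hode : ∀ t : ℝ, t < 0 → HasDerivAt a
      (bigLam ε₀ / s ^ 2 * a (t / s) ^ 2 - s / bigLam ε₀ * a t * a (s * t)) t)
    (hsq : IntegrableOn (fun t => a t ^ 2) (Iio 0)) (hne : ∃ t : ℝ, t < 0 ∧ a t ≠ 0) :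
    0 < ∫ t in Iio 0, a t ^ 2 := by
  obtain ⟨t₁, ht₁, hat₁⟩ := hne
  have hev : ∀ᶠ y in 𝓝 t₁, a y ≠ 0 := (hode t₁ ht₁).continuousAt.eventually_ne hat₁
  obtain ⟨ε, hε, hball⟩ := Metric.eventually_nhds_iff.1 hev
  set δ : ℝ := min ε (-t₁) with hδ
  have hδ0 : 0 < δ := lt_min hε (neg_pos.2 ht₁)
  have hsub : Ioo (t₁ - δ) (t₁ + δ) ⊆ Function.support (fun t => a t ^ 2) ∩ Iio 0 := by
    intro y hy
    refine ⟨?_, ?_⟩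
    · rw [Function.mem_support]
      have : a y ≠ 0 := hball (by
        rw [Real.dist_eq, abs_lt]; constructor <;> linarith [hy.1, hy.2, min_le_left ε (-t₁)])
      exact pow_ne_zero 2 this
    · show y < 0
      linarith [hy.2, min_le_right ε (-t₁)]
  rw [setIntegral_pos_iff_support_of_nonneg_ae
    ((ae_restrict_iff' measurableSet_Iio).2 (Eventually.of_forall fun t _ => sq_nonneg (a t))) hsq]
  refine lt_of_lt_of_le ?_ (measure_mono hsub)
  rw [Real.volume_Ioo]
  exact ENNReal.ofReal_pos.2 (by linarith)

/-! ## Unconditional form on the construction item's clauses -/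

/-- A non-trivial admissible scalar front is SUB-UNITARY: `s ≤ Λ` (the tree's `IsDSSWave.dssMu_le_one` through
the dictionary `isDSSWave_dyadic_of_scalarFront`). [cite: Tao2016AveragedNS, §4; cell theorem] -/
theorem le_bigLam_of_front (hε : 0 < ε₀) (hs : 1 < s)
    (hode : ∀ t : ℝ, t < 0 → HasDerivAt a
      (bigLam ε₀ / s ^ 2 * a (t / s) ^ 2 - s / bigLam ε₀ * a t * a (s * t)) t)
    (hint : IntegrableOn a (Iio 0))
    (hbdd : ∃ t₀ : ℝ, t₀ < 0 ∧ ∃ P : ℝ, ∀ t : ℝ, t₀ ≤ t → t < 0 → |a t| ≤ P)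
    (hne : ∃ t : ℝ, t < 0 ∧ a t ≠ 0) : s ≤ bigLam ε₀ := by
  obtain ⟨t₁, ht₁, hat₁⟩ := hne
  have hs0 : 0 < s := by linarith
  have hW := isDSSWave_dyadic_of_scalarFront hε hs hode hint hbdd
  have hne' : (fun (_ : Fin 1) (x : ℝ) => (Real.exp (-x) * a (-Real.exp (-x))) •
      EuclideanSpace.single (0 : Fin 4) (1 : ℝ)) 0 (-Real.log (-t₁)) ≠ 0 := by
    have ht : -Real.exp (-(-Real.log (-t₁))) = t₁ := by
      rw [neg_neg, Real.exp_log (neg_pos.2 ht₁), neg_neg]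
    simp only [ht]
    intro h0
    rw [smul_eq_zero] at h0
    rcases h0 with h0 | h0
    · exact (mul_ne_zero (Real.exp_pos _).ne' hat₁) h0
    · exact one_ne_zero ((PiLp.single_eq_zero_iff 2 (0 : Fin 4)).1 h0)
  have hμ := hW.dssMu_le_one (r := 0) (x := -Real.log (-t₁)) hε (inTableClass_dyadicTable le_rfl).2.1 hne'
  unfold dssMu at hμ
  rw [show 2 * Real.log s = Real.log (s ^ 2) by rw [Real.log_pow]; norm_num, Real.exp_log (by positivity),
    div_le_one (by positivity), ← bigLam_sq hε.le] at hμ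
  exact (pow_le_pow_iff_left₀ hs0.le (bigLam_pos (by linarith)).le two_ne_zero).1 hμ

/-- **No perfect conveyor: every non-trivial admissible scalar dyadic front strands a strictly positive
wake**, `a(0⁻) > 0` — for every profile with the clauses of `DyadicScalarFronts` (front equation on `t < 0`,
integrable on `(−∞,0)`, bounded near `0⁻`, non-trivial), whatever its sign pattern.
[cite: Tao2016AveragedNS, §1.2, §4; elementary] -/
theorem wake_pos_of_front (hε : 0 < ε₀) (hs : 1 < s)
    (hode : ∀ t : ℝ, t < 0 → HasDerivAt a
      (bigLam ε₀ / s ^ 2 * a (t / s) ^ 2 - s / bigLam ε₀ * a t * a (s * t)) t)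
    (hint : IntegrableOn a (Iio 0))
    (hbdd : ∃ t₀ : ℝ, t₀ < 0 ∧ ∃ P : ℝ, ∀ t : ℝ, t₀ ≤ t → t < 0 → |a t| ≤ P)
    (hne : ∃ t : ℝ, t < 0 ∧ a t ≠ 0) :
    ∃ L : ℝ, Tendsto a (𝓝[<] 0) (𝓝 L) ∧ 0 < L := by
  obtain ⟨L, hL⟩ := exists_wake_limit hε hs hode hbdd
  obtain ⟨P', hP'⟩ := bounded hε hs hode hint hbdd
  have hb := tendsto_atBot hε hs hode hint hbdd
  have hfloor := wake_lower_bound hε hs hode hP' hint hb hL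
  have hc := floor_coeff_pos hε hs (le_bigLam_of_front hε hs hode hint hbdd hne)
  have hI := sq_integral_pos hode (integrableOn_sq (continuousOn_of_ode hode) hP' hint) hne
  exact ⟨L, hL, lt_of_lt_of_le (mul_pos hc hI) hfloor⟩

/-- **Strict sub-unitarity: `μ < 1`.**  Every non-trivial admissible scalar dyadic front has `s < Λ`, i.e.
`dssMu ε₀ (log s) < 1` — the equality case `s = Λ` would make the wake–throughput identity give `a(0⁻) = 0`,
contradicting `wake_pos_of_front`. [cite: Tao2016AveragedNS, §1.2, §4 (4.1); elementary] -/
theorem dssMu_lt_one_of_front (hε : 0 < ε₀) (hs : 1 < s)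
    (hode : ∀ t : ℝ, t < 0 → HasDerivAt a
      (bigLam ε₀ / s ^ 2 * a (t / s) ^ 2 - s / bigLam ε₀ * a t * a (s * t)) t)
    (hint : IntegrableOn a (Iio 0))
    (hbdd : ∃ t₀ : ℝ, t₀ < 0 ∧ ∃ P : ℝ, ∀ t : ℝ, t₀ ≤ t → t < 0 → |a t| ≤ P)
    (hne : ∃ t : ℝ, t < 0 ∧ a t ≠ 0) :
    s < bigLam ε₀ ∧ dssMu ε₀ (Real.log s) < 1 := by
  have hs0 : 0 < s := by linarith
  have hΛ : 0 < bigLam ε₀ := bigLam_pos (by linarith)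
  obtain ⟨L, hL, hLpos⟩ := wake_pos_of_front hε hs hode hint hbdd hne
  obtain ⟨L', hL', hid⟩ := wake_identity_of_front hε hs hode hint hbdd
  have hLL : L' = L := tendsto_nhds_unique hL' hL
  rw [hLL] at hid
  have hle := le_bigLam_of_front hε hs hode hint hbdd hne
  have hlt : s < bigLam ε₀ := by
    rcases hle.lt_or_eq with h | h
    · exact h
    · exfalso
      rw [h, div_self hΛ.ne', sub_self, mul_zero, zero_mul] at hid
      exact absurd hid (pow_ne_zero 2 hLpos.ne')
  refine ⟨hlt, ?_⟩
  unfold dssMu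
  rw [show 2 * Real.log s = Real.log (s ^ 2) by rw [Real.log_pow]; norm_num, Real.exp_log (by positivity),
    div_lt_one (by positivity), ← bigLam_sq hε.le]
  exact pow_lt_pow_left₀ hlt hs0.le two_ne_zero

end WakeRatchetScalarFrontPositiveWake

end Summit.NavierStokesRegularity.NavierStokesRegularity.Theorems

end
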